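import Literature.NumberTheory.EllipticCurves.QuadraticTwistTateFormTwoProofs
import Literature.NumberTheory.DiophantineGeometry.TateAlgorithmMordellCharTwoProofs
import Literature.NumberTheory.DiophantineGeometry.LocalReductionFiniteBadPlacesProofs
import HarnessLib

/-!
# The Mordell curves `y² = x³ + k` over `ℚ` at `2`: Kodaira types, `ord₂ Δ_min`, and `δ₂ ∈ {0, 2, 4}`

`Proofs` file (theorems only, no definitions, no named facts) in topic
`NumberTheory/EllipticCurves`, landed by the seat of bsd.S15
(`Literature.NumberTheory.EllipticCurves.conductorNorm_eq_artinConductorNat`) as the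
**discriminant side of Ogg's formula at `2` for the curves of invariant `j = 0` over `ℚ`** (the
Galois side is `MordellCurveSwanConductorProofs`; the assembly `OggFormulaJZeroTwoProofs`).

Let `W : y² = x³ + k` over `ℚ` (`a₁ = a₂ = a₃ = a₄ = 0`, `a₆ = k ∈ ℤ`), `k = 2ᵃu` with `u` odd,
`a ≤ 5`, and let `v` be the place above `2`.  The equation is `2`-integral with
`|Δ|₂ = |{-432k²}|₂ = 2^{-(2a+4)}`, `c₄ = 0`, `c₆ = -864k` (`mordell_baseChange_data`); it is
minimal at `2` — for `a ≤ 3` because `ord₂ Δ < 12` (`isMinimal_of_exp_neg_twelve_lt_valued_Δ`),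
for `a = 4, u ≡ 3 (mod 4)` and `a = 5` because Kraus's necessary condition fails for the only
possible descent (`isMinimal_of_kraus_fails_of_Δ`, `kraus_fails_of_c₄_eq_zero`: the descended pair
is `(0, q/w⁶)` with `q = -216u`, resp. `-432u`).  Tate's algorithm on its `ℤ₂`-structure is
`TateAlgorithmMordellCharTwoProofs`, the shape of `a₆` modulo powers of `ϖ` being read from `k`
(`|4 - ϖ²|₂ ≤ 2⁻⁵`, `|16 - ϖ⁴|₂ ≤ 2⁻⁷` for any uniformiser `ϖ` of `ℤ₂`):

| `k`                     | type  | `ord₂ Δ_min` | `f₂` | `δ₂` |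
|-------------------------|-------|--------------|------|------|
| `u`, `u ≡ 1 (mod 4)`    | IV    | 4            | 2    | 0    |
| `u`, `u ≡ 3 (mod 4)`    | II    | 4            | 4    | 2    |
| `2u`                    | II    | 6            | 6    | 4    |
| `4u`, `u ≡ 1 (mod 4)`   | IV*   | 8            | 2    | 0    |
| `4u`, `u ≡ 3 (mod 4)`   | I₀*   | 8            | 4    | 2    |
| `8u`                    | I₀*   | 10           | 6    | 4    |
| `16u`, `u ≡ 1 (mod 4)`  | good (`y² + y = x³ + (u-1)/4`) | — | 0 | — |
| `16u`, `u ≡ 3 (mod 4)`  | II*   | 12           | 4    | 2    |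
| `32u`                   | II*   | 14           | 6    | 4    |

(`kodairaSymbolAt_and_ordMinimalDiscriminant_mordell_*`,
`hasGoodReductionAt_mordell_four_of_emod_four_eq_one`).  Summary
(`exists_sq_mul_wildConductorExponent_mordell`): for `64 ∤ k` and `W` additive at `v`,
`k = c²k₀` (`c = 2^{⌊a/2⌋}`, `k₀ = u` or `2u`) with **`δ₂ = 0, 2, 4` as `k₀ ≡ 1, 3, 2 (mod 4)`** —
twice the upper break of `ℚ₂(√k₀)`, as Ogg's formula demands
(`MordellCurveSwanConductorProofs`).  Silverman *ATAEC* IV.9.4, Table 4.1, IV.11.1.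

## References

* J. H. Silverman, *Advanced Topics in the Arithmetic of Elliptic Curves*, GTM 151 (1994), IV.9.4
  (Tate's algorithm, PDF pp. 344–346), Table 4.1, IV.11.1 (Ogg's formula, p. 365).
  [SilvermanATAEC1994]
* A. Kraus, *Quelques remarques à propos des invariants c₄, c₆ et Δ d'une courbe elliptique*, Acta
  Arith. 54 (1989), Prop. 2. [Kraus1989]
* J. H. Silverman, *The Arithmetic of Elliptic Curves*, 2nd ed. (2009), VII.1 Remark 1.1, VII.5
  Prop. 5.1(a), X.6. [SilvermanAEC2009]
-/

noncomputable section

open scoped Classical NumberField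
open IsDedekindDomain Rat.HeightOneSpectrum Literature.NumberTheory.DiophantineGeometry
  Literature.NumberTheory.DiophantineGeometry.TateAlgorithm Literature.NumberTheory.EllipticCurves
  Literature.NumberTheory.GaloisRepresentations

namespace WeierstrassCurve

/-! ### Two minimality criteria at `2` -/

section Minimality

variable (v : HeightOneSpectrum (𝓞 ℚ))

/-- **An integral equation with `|Δ|₂ > 2⁻¹²` is minimal** (Silverman *AEC* VII.1 Remark 1.1), in
the `Valued.v` form of `isMinimal_of_exp_lt_valuation_Δ` (`RootNumberTwistProofs`).
[cite: SilvermanAEC2009, VII.1 Remark 1.1] -/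
theorem isMinimal_of_exp_neg_twelve_lt_valued_Δ (Y : WeierstrassCurve (v.adicCompletion ℚ))
    [Y.IsIntegral (v.adicCompletionIntegers ℚ)]
    (h : WithZero.exp (-12 : ℤ) < Valued.v Y.Δ) : Y.IsMinimal (v.adicCompletionIntegers ℚ) := by
  have hV1 := valued_le_one_iff_mem_range_adicCompletionIntegers (K := ℚ) v
  rw [isMinimal_iff_of_le_one_iff hV1]
  refine ⟨inferInstance, fun C hC ↦ ?_⟩
  haveI := hC
  have hint : Valued.v (C • Y).Δ ≤ 1 :=
    (hV1 _).mpr ⟨_, integralModel_Δ_eq (v.adicCompletionIntegers ℚ) (C • Y)⟩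
  rw [variableChange_Δ, Valuation.map_mul, Valuation.map_pow] at hint ⊢
  set a := Valued.v (↑C.u⁻¹ : v.adicCompletion ℚ) with ha
  set d := Valued.v Y.Δ with hd
  have ha0 : a ≠ 0 := (Valuation.ne_zero_iff _).mpr (Units.ne_zero _)
  have hd0 : d ≠ 0 := (WithZero.exp_pos.trans h).ne'
  have had0 : a ^ 12 * d ≠ 0 := mul_ne_zero (pow_ne_zero _ ha0) hd0
  have h1 : -12 < WithZero.log d := WithZero.lt_log_of_exp_lt h
  have h2 : 12 • WithZero.log a + WithZero.log d ≤ 0 := by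
    rw [← WithZero.log_pow, ← WithZero.log_mul (pow_ne_zero _ ha0) hd0, ← WithZero.log_one]
    exact (WithZero.log_le_log had0 one_ne_zero).mpr hint
  refine (WithZero.log_le_log had0 hd0).mp ?_
  rw [WithZero.log_mul (pow_ne_zero _ ha0) hd0, WithZero.log_pow]
  simp only [nsmul_eq_mul, Nat.cast_ofNat] at h2 ⊢
  omega

/-- **Minimality at `2` from the failure of Kraus's conditions, discriminant form.**  Let `X` be
a `2`-adically integral Weierstrass equation over `ℚ₂` with `|Δ(X)|₂ > 2⁻²⁴`.  If for no `2`-adic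
unit `w` the pair `(c₄(X)/(16w⁴), c₆(X)/(64w⁶))` satisfies Kraus's necessary condition
(`kraus_two_of_integral`), then `X` is minimal: an integral `C • X` with `|u| < 1` has
`|Δ(C • X)| = |u|⁻¹²|Δ(X)| ≤ 1`, forcing `u = 2w` with `w` a unit, and then
`c₄(C • X) = c₄(X)/(16w⁴)`, `c₆(C • X) = c₆(X)/(64w⁶)` would satisfy Kraus's condition.  (Variant
of `isMinimal_of_kraus_fails`, `QuadraticTwistTateFormTwoProofs`, for curves with `c₄ = 0`.)
Kraus 1989, Prop. 2; Silverman *AEC* VII.1. [cite: Kraus1989, Prop. 2]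
[cite: SilvermanAEC2009, VII.1 (minimal equations) and III.1 Table 3.1] -/
theorem isMinimal_of_kraus_fails_of_Δ (hv : natGenerator v = 2)
    (Y : WeierstrassCurve (v.adicCompletion ℚ)) [Y.IsIntegral (v.adicCompletionIntegers ℚ)]
    (hΔ : WithZero.exp (-24 : ℤ) < Valued.v Y.Δ)
    (hK : ∀ w : v.adicCompletion ℚ, Valued.v w = 1 →
      ¬ ((Valued.v (Y.c₄ / (16 * w ^ 4)) ≤ WithZero.exp (-4 : ℤ) ∧
          (Valued.v (Y.c₆ / (64 * w ^ 6)) ≤ WithZero.exp (-5 : ℤ) ∨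
            Valued.v (Y.c₆ / (64 * w ^ 6) - 8) ≤ WithZero.exp (-5 : ℤ))) ∨
        Valued.v (Y.c₆ / (64 * w ^ 6) + 1) ≤ WithZero.exp (-2 : ℤ))) :
    Y.IsMinimal (v.adicCompletionIntegers ℚ) := by
  have V2 := valued_two v hv
  have h20 : (2 : v.adicCompletion ℚ) ≠ 0 := by
    intro h; rw [h, Valuation.map_zero] at V2; exact WithZero.coe_ne_zero V2.symm
  have hV1 : ∀ x : v.adicCompletion ℚ, x ∈ (algebraMap (v.adicCompletionIntegers ℚ) (v.adicCompletion ℚ)).range → Valued.v x ≤ 1 :=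
    fun x hx ↦ (valued_le_one_iff_mem_range_adicCompletionIntegers v x).mpr hx
  rw [isMinimal_iff_of_le_one_iff (valued_le_one_iff_mem_range_adicCompletionIntegers v)]
  refine ⟨inferInstance, fun C hC ↦ ?_⟩
  haveI := hC
  have hint : Valued.v (C • Y).Δ ≤ 1 := hV1 _ ⟨_, integralModel_Δ_eq (v.adicCompletionIntegers ℚ) (C • Y)⟩
  rw [variableChange_Δ, Valuation.map_mul, Valuation.map_pow] at hint ⊢
  set U : WithZero (Multiplicative ℤ) := Valued.v (↑C.u⁻¹ : v.adicCompletion ℚ) with hU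
  by_cases hU1 : U ≤ 1
  · exact mul_le_of_le_one_left zero_le (pow_le_one₀ zero_le hU1)
  exfalso
  replace hU1 : 1 < U := not_le.mp hU1
  have hU0 : U ≠ 0 := (Valuation.ne_zero_iff _).mpr (Units.ne_zero _)
  -- integrality of `Δ(C • Y)` forces `ord(u) = 1`
  have hd0 : Valued.v Y.Δ ≠ 0 := (WithZero.exp_pos.trans hΔ).ne'
  have hUe : U = WithZero.exp (1 : ℤ) := by
    have hl1 : 0 < WithZero.log U := WithZero.lt_log_of_exp_lt (by rwa [WithZero.exp_zero])
    have h1 : -24 < WithZero.log (Valued.v Y.Δ) := WithZero.lt_log_of_exp_lt hΔ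
    have h2 : 12 • WithZero.log U + WithZero.log (Valued.v Y.Δ) ≤ 0 := by
      rw [← WithZero.log_pow, ← WithZero.log_mul (pow_ne_zero _ hU0) hd0, ← WithZero.log_one]
      exact (WithZero.log_le_log (mul_ne_zero (pow_ne_zero _ hU0) hd0) one_ne_zero).mpr hint
    have hlog : WithZero.log U = 1 := by
      simp only [nsmul_eq_mul, Nat.cast_ofNat] at h2
      omega
    rw [← WithZero.exp_log hU0, hlog]
  -- the unit `w = u / 2`
  set w : v.adicCompletion ℚ := (C.u : v.adicCompletion ℚ) / 2 with hw
  have hw1 : Valued.v w = 1 := by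
    have hu : Valued.v ((C.u : v.adicCompletion ℚ)) = WithZero.exp (-1 : ℤ) := by
      have h1 : Valued.v ((C.u : v.adicCompletion ℚ)) * U = 1 := by
        rw [hU, ← Valuation.map_mul, Units.mul_inv, Valuation.map_one]
      rw [hUe] at h1
      calc Valued.v ((C.u : v.adicCompletion ℚ)) = Valued.v ((C.u : v.adicCompletion ℚ)) * WithZero.exp (1 : ℤ) * WithZero.exp (-1 : ℤ) := by
            rw [mul_assoc, withZero_exp_mul_exp]; simp
        _ = WithZero.exp (-1 : ℤ) := by rw [h1, one_mul]
    rw [hw, map_div₀, hu, V2, div_self (WithZero.coe_ne_zero)]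
  have hu2w : (C.u : v.adicCompletion ℚ) = 2 * w := by rw [hw]; field_simp
  have hinv4 : (↑C.u⁻¹ : v.adicCompletion ℚ) ^ 4 * Y.c₄ = Y.c₄ / (16 * w ^ 4) := by
    rw [Units.val_inv_eq_inv_val, hu2w, inv_pow, mul_pow, mul_comm, div_eq_mul_inv]
    norm_num
  have hinv6 : (↑C.u⁻¹ : v.adicCompletion ℚ) ^ 6 * Y.c₆ = Y.c₆ / (64 * w ^ 6) := by
    rw [Units.val_inv_eq_inv_val, hu2w, inv_pow, mul_pow, mul_comm, div_eq_mul_inv]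
    norm_num
  -- Kraus for the integral `C • Y`
  obtain ⟨i1, i2, i3, i4, i6⟩ := (isIntegral_iff_forall_mem_range (C • Y)).mp hC
  have hKr := kraus_two_of_integral v hv (C • Y) (hV1 _ i1) (hV1 _ i2) (hV1 _ i3) (hV1 _ i4)
    (hV1 _ i6)
  rw [variableChange_c₄, variableChange_c₆, hinv4, hinv6] at hKr
  exact hK w hw1 hKr

end Minimality

/-! ### `2`-adic valuation helpers -/

section Helpers

variable (v : HeightOneSpectrum (𝓞 ℚ))

/-- `|ϖ|_v = 2⁻¹` and `|ε|_v = 1` when `2 = ϖε` in `O_v` (`v ∣ 2`). [folklore] -/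
theorem valued_uniformizer_and_eps (hv : natGenerator v = 2) {ε : v.adicCompletionIntegers ℚ}
    (hεu : IsUnit ε)
    (h2ε : (2 : v.adicCompletionIntegers ℚ) = uniformizer (v.adicCompletionIntegers ℚ) * ε) :
    Valued.v ((uniformizer (v.adicCompletionIntegers ℚ) : v.adicCompletionIntegers ℚ) :
        v.adicCompletion ℚ) = WithZero.exp (-1 : ℤ) ∧
      Valued.v ((ε : v.adicCompletionIntegers ℚ) : v.adicCompletion ℚ) = 1 := by
  have hε1 : Valued.v ((ε : v.adicCompletionIntegers ℚ) : v.adicCompletion ℚ) = 1 :=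
    (HeightOneSpectrum.adicCompletionIntegers.isUnit_iff_valued_eq_one).mp hεu
  refine ⟨?_, hε1⟩
  have h2 : (2 : v.adicCompletion ℚ) =
      (uniformizer (v.adicCompletionIntegers ℚ) : v.adicCompletion ℚ) * (ε : v.adicCompletion ℚ) := by
    have := congrArg (fun x : v.adicCompletionIntegers ℚ ↦ (x : v.adicCompletion ℚ)) h2ε
    push_cast at this; exact this
  have V2 := valued_two v hv
  rw [h2, Valuation.map_mul, hε1, mul_one] at V2
  exact V2

/-- `|(ϖε)^{2} - ϖ²·1|`-type estimate: `|2² - ϖ²|_v ≤ 2⁻⁵` (`4 = ϖ²ε²`, `|ε² - 1| ≤ 2⁻³`).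
[folklore] -/
theorem valued_four_sub_uniformizer_sq_le (hv : natGenerator v = 2)
    {ε : v.adicCompletionIntegers ℚ} (hεu : IsUnit ε)
    (h2ε : (2 : v.adicCompletionIntegers ℚ) = uniformizer (v.adicCompletionIntegers ℚ) * ε) :
    Valued.v ((4 : v.adicCompletion ℚ) -
      ((uniformizer (v.adicCompletionIntegers ℚ) : v.adicCompletionIntegers ℚ) :
        v.adicCompletion ℚ) ^ 2) ≤ WithZero.exp (-5 : ℤ) := by
  obtain ⟨hϖ, hε⟩ := valued_uniformizer_and_eps v hv hεu h2ε
  set π : v.adicCompletion ℚ := ((uniformizer (v.adicCompletionIntegers ℚ) :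
    v.adicCompletionIntegers ℚ) : v.adicCompletion ℚ)
  set e : v.adicCompletion ℚ := ((ε : v.adicCompletionIntegers ℚ) : v.adicCompletion ℚ)
  have h2 : (2 : v.adicCompletion ℚ) = π * e := by
    have := congrArg (fun x : v.adicCompletionIntegers ℚ ↦ (x : v.adicCompletion ℚ)) h2ε
    push_cast at this; exact this
  have e4 : (4 : v.adicCompletion ℚ) - π ^ 2 = π ^ 2 * (e ^ 2 - 1) := by
    rw [show (4 : v.adicCompletion ℚ) = 2 ^ 2 by norm_num, h2]; ring
  rw [e4, Valuation.map_mul, Valuation.map_pow, hϖ, ← WithZero.exp_nsmul]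
  calc WithZero.exp (2 • (-1 : ℤ)) * Valued.v (e ^ 2 - 1)
        ≤ WithZero.exp (2 • (-1 : ℤ)) * WithZero.exp (-3 : ℤ) :=
        mul_le_mul' le_rfl (valued_sq_sub_one_le_of_valued_eq_one v hv hε)
    _ = WithZero.exp (-5 : ℤ) := by rw [withZero_exp_mul_exp]; norm_num

end Helpers

section Helpers2

variable (v : HeightOneSpectrum (𝓞 ℚ))

/-- `|m|_v = 2⁻ᵉ` for `m = 2ᵉm'` with `m'` odd. [folklore] -/
theorem valuation_intCast_of_eq_two_pow_mul (hv : natGenerator v = 2) {m m' : ℤ} {e : ℕ}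
    (hm : m = 2 ^ e * m') (hm' : ¬ (2 : ℤ) ∣ m') :
    v.valuation ℚ (m : ℚ) = WithZero.exp (-(e : ℤ)) := by
  have hv2 : v.valuation ℚ (2 : ℚ) = WithZero.exp (-1 : ℤ) := by
    have := Rat.valuation_natGenerator v; rwa [hv, Nat.cast_ofNat] at this
  have h1 : v.valuation ℚ (m' : ℚ) = 1 :=
    Rat.valuation_intCast_eq_one v (by rw [hv]; exact_mod_cast hm')
  rw [hm]; push_cast
  rw [map_mul, map_pow, hv2, h1, mul_one, ← WithZero.exp_nsmul]; simp

/-- `|m|_v ≤ 2⁻ᵉ` for `2ᵉ ∣ m`. [folklore] -/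
theorem valuation_intCast_le_of_two_pow_dvd (hv : natGenerator v = 2) {m : ℤ} {e : ℕ}
    (hm : (2 : ℤ) ^ e ∣ m) :
    v.valuation ℚ (m : ℚ) ≤ WithZero.exp (-(e : ℤ)) :=
  Rat.valuation_intCast_le v (by rw [hv]; exact_mod_cast hm)

end Helpers2

/-! ### The Mordell equation `y² = x³ + k`, `k = 2ᵃu`, over `ℚ₂` -/

section MordellData

variable (v : HeightOneSpectrum (𝓞 ℚ))

/-- **The equation `y² = x³ + k` over `ℚ_v`, `v ∣ 2`, `k = 2ᵃu` with `u` odd**: it is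
`v`-integral, `|a₆|_v = 2⁻ᵃ`, `|Δ|_v = |{-432k²}|_v = 2^{-(2a+4)}`, `c₄ = 0`, `c₆ = -864k`.
[cite: SilvermanAEC2009, III.1 (b₂, …, c₆, Δ)] -/
theorem mordell_baseChange_data (hv : natGenerator v = 2) (W : WeierstrassCurve ℚ)
    (h₁ : W.a₁ = 0) (h₂ : W.a₂ = 0) (h₃ : W.a₃ = 0) (h₄ : W.a₄ = 0) {k : ℤ}
    (ha₆ : W.a₆ = (k : ℚ)) {a : ℕ} {u : ℤ} (hu : ¬ (2 : ℤ) ∣ u) (hk : k = 2 ^ a * u) :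
    (W.baseChange (v.adicCompletion ℚ)).IsIntegral (v.adicCompletionIntegers ℚ) ∧
      Valued.v (W.baseChange (v.adicCompletion ℚ)).Δ = WithZero.exp (-((2 * a + 4 : ℕ) : ℤ)) ∧
      (W.baseChange (v.adicCompletion ℚ)).c₄ = 0 ∧
      (W.baseChange (v.adicCompletion ℚ)).c₆ = -864 * (k : v.adicCompletion ℚ) ∧
      Valued.v (W.baseChange (v.adicCompletion ℚ)).a₆ = WithZero.exp (-(a : ℤ)) ∧
      (W.baseChange (v.adicCompletion ℚ)).a₁ = 0 ∧ (W.baseChange (v.adicCompletion ℚ)).a₂ = 0 ∧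
      (W.baseChange (v.adicCompletion ℚ)).a₃ = 0 ∧ (W.baseChange (v.adicCompletion ℚ)).a₄ = 0 ∧
      (W.baseChange (v.adicCompletion ℚ)).a₆ = algebraMap ℚ (v.adicCompletion ℚ) (k : ℚ) := by
  have hv2 : v.valuation ℚ (2 : ℚ) = WithZero.exp (-1 : ℤ) := by
    have := Rat.valuation_natGenerator v; rwa [hv, Nat.cast_ofNat] at this
  have hvpow : ∀ n : ℕ, v.valuation ℚ ((2 : ℚ) ^ n) = WithZero.exp (-(n : ℤ)) := fun n ↦ by
    rw [map_pow, hv2, ← WithZero.exp_nsmul]; simp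
  have hvu : v.valuation ℚ (u : ℚ) = 1 :=
    Rat.valuation_intCast_eq_one v (by rw [hv]; exact_mod_cast hu)
  have hvk : v.valuation ℚ (k : ℚ) = WithZero.exp (-(a : ℤ)) := by
    rw [hk]; push_cast; rw [map_mul, hvpow, hvu, mul_one]
  have h27 : v.valuation ℚ (27 : ℚ) = 1 := by
    have := Rat.valuation_intCast_eq_one v (n := 27) (by rw [hv]; decide)
    exact_mod_cast this
  have hΔ : W.Δ = -432 * (k : ℚ) ^ 2 := by
    rw [← ha₆]
    simp only [WeierstrassCurve.Δ, WeierstrassCurve.b₂, WeierstrassCurve.b₄, WeierstrassCurve.b₆,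
      WeierstrassCurve.b₈, h₁, h₂, h₃, h₄]
    ring
  have hvΔ : v.valuation ℚ W.Δ = WithZero.exp (-((2 * a + 4 : ℕ) : ℤ)) := by
    rw [hΔ, show (-432 : ℚ) * (k : ℚ) ^ 2 = -(2 ^ 4 * 27 * (k : ℚ) ^ 2) by norm_num,
      Valuation.map_neg, map_mul, map_mul, hvpow, h27, mul_one, map_pow, hvk,
      ← WithZero.exp_nsmul, withZero_exp_mul_exp]
    congr 1; push_cast; ring
  have hc₄ : W.c₄ = 0 := by
    simp only [WeierstrassCurve.c₄, WeierstrassCurve.b₂, WeierstrassCurve.b₄, h₁, h₂, h₃, h₄]; ring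
  have hc₆ : W.c₆ = -864 * (k : ℚ) := by
    rw [← ha₆]
    simp only [WeierstrassCurve.c₆, WeierstrassCurve.b₂, WeierstrassCurve.b₄, WeierstrassCurve.b₆,
      h₁, h₂, h₃, h₄]; ring
  have hexp1 : ∀ n : ℕ, WithZero.exp (-(n : ℤ)) ≤ (1 : WithZero (Multiplicative ℤ)) := fun n ↦ by
    rw [← WithZero.exp_zero, WithZero.exp_le_exp]; omega
  have hint : W.IsIntegralAt v := by
    refine W.isIntegralAt_of_valuation_le_one v ?_ ?_ ?_ ?_ ?_
    · rw [h₁, map_zero]; exact zero_le_one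
    · rw [h₂, map_zero]; exact zero_le_one
    · rw [h₃, map_zero]; exact zero_le_one
    · rw [h₄, map_zero]; exact zero_le_one
    · rw [ha₆, hvk]; exact hexp1 a
  refine ⟨hint, ?_, ?_, ?_, ?_, ?_, ?_, ?_, ?_, ?_⟩
  · rw [WeierstrassCurve.baseChange, map_Δ, valued_algebraMap_adicCompletion, hvΔ]
  · rw [WeierstrassCurve.baseChange, map_c₄, hc₄, map_zero]
  · rw [WeierstrassCurve.baseChange, map_c₆, hc₆, map_mul, map_neg, map_intCast, map_ofNat]
  · rw [WeierstrassCurve.baseChange, map_a₆, valued_algebraMap_adicCompletion, ha₆, hvk]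
  · rw [WeierstrassCurve.baseChange, map_a₁, h₁, map_zero]
  · rw [WeierstrassCurve.baseChange, map_a₂, h₂, map_zero]
  · rw [WeierstrassCurve.baseChange, map_a₃, h₃, map_zero]
  · rw [WeierstrassCurve.baseChange, map_a₄, h₄, map_zero]
  · rw [WeierstrassCurve.baseChange, map_a₆, ha₆]

/-- The integral model over `ℤ₂` of `y² = x³ + 2ᵃu`: `a₁ = a₂ = a₃ = a₄ = 0`, `a₆ = ϖᵃγ` with `γ`
a unit, `ord Δ = 2a + 4`, together with `2 = ϖε`. [folklore] -/
theorem mordell_integralModel_data (hv : natGenerator v = 2) (W : WeierstrassCurve ℚ)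
    (h₁ : W.a₁ = 0) (h₂ : W.a₂ = 0) (h₃ : W.a₃ = 0) (h₄ : W.a₄ = 0) {k : ℤ}
    (ha₆ : W.a₆ = (k : ℚ)) {a : ℕ} {u : ℤ} (hu : ¬ (2 : ℤ) ∣ u) (hk : k = 2 ^ a * u) :
    ∃ _ : (W.baseChange (v.adicCompletion ℚ)).IsIntegral (v.adicCompletionIntegers ℚ),
      ((W.baseChange (v.adicCompletion ℚ)).integralModel (v.adicCompletionIntegers ℚ)).a₁ = 0 ∧
      ((W.baseChange (v.adicCompletion ℚ)).integralModel (v.adicCompletionIntegers ℚ)).a₂ = 0 ∧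
      ((W.baseChange (v.adicCompletion ℚ)).integralModel (v.adicCompletionIntegers ℚ)).a₃ = 0 ∧
      ((W.baseChange (v.adicCompletion ℚ)).integralModel (v.adicCompletionIntegers ℚ)).a₄ = 0 ∧
      ((((W.baseChange (v.adicCompletion ℚ)).integralModel (v.adicCompletionIntegers ℚ)).a₆ :
          v.adicCompletionIntegers ℚ) : v.adicCompletion ℚ) = algebraMap ℚ (v.adicCompletion ℚ) (k : ℚ) ∧
      (∃ γ : v.adicCompletionIntegers ℚ, IsUnit γ ∧
        ((W.baseChange (v.adicCompletion ℚ)).integralModel (v.adicCompletionIntegers ℚ)).a₆ =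
          uniformizer (v.adicCompletionIntegers ℚ) ^ a * γ) ∧
      (IsDiscreteValuationRing.addVal (v.adicCompletionIntegers ℚ)
        ((W.baseChange (v.adicCompletion ℚ)).integralModel (v.adicCompletionIntegers ℚ)).Δ).toNat
          = 2 * a + 4 := by
  obtain ⟨hint, hXΔ, -, -, hva₆, e1, e2, e3, e4, e6⟩ :=
    mordell_baseChange_data v hv W h₁ h₂ h₃ h₄ ha₆ hu hk
  haveI := hint
  set X := W.baseChange (v.adicCompletion ℚ) with hX
  set O := v.adicCompletionIntegers ℚ with hO
  have hinj : Function.Injective (algebraMap O (v.adicCompletion ℚ)) := IsFractionRing.injective _ _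
  refine ⟨hint, ?_, ?_, ?_, ?_, ?_, ?_, ?_⟩
  · apply hinj; rw [integralModel_a₁_eq, e1, map_zero]
  · apply hinj; rw [integralModel_a₂_eq, e2, map_zero]
  · apply hinj; rw [integralModel_a₃_eq, e3, map_zero]
  · apply hinj; rw [integralModel_a₄_eq, e4, map_zero]
  · rw [show (((X.integralModel O).a₆ : O) : v.adicCompletion ℚ) = X.a₆ from integralModel_a₆_eq O X, e6]
  · refine exists_isUnit_eq_uniformizer_pow_mul_of_valued_eq v ?_
    rw [show (((X.integralModel O).a₆ : O) : v.adicCompletion ℚ) = X.a₆ from integralModel_a₆_eq O X, hva₆]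
  · refine addVal_toNat_eq_of_valued_eq v ?_
    rw [show (((X.integralModel O).Δ : O) : v.adicCompletion ℚ) = X.Δ from integralModel_Δ_eq O X, hXΔ]

/-- Reading `kodairaSymbolAt` and `ord Δ_min` on `y² = x³ + k` itself when it is minimal at `2`.
[cite: SilvermanATAEC1994, IV.9.4] -/
theorem kodairaSymbolAt_and_ordMinimalDiscriminant_mordell_of_isMinimal
    [PerfectField (IsLocalRing.ResidueField (v.adicCompletionIntegers ℚ))]
    (W : WeierstrassCurve ℚ) [W.IsElliptic]
    [hmin : (W.baseChange (v.adicCompletion ℚ)).IsMinimal (v.adicCompletionIntegers ℚ)]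
    {T : KodairaSymbol} {n : ℕ}
    (hK : ((W.baseChange (v.adicCompletion ℚ)).integralModel
      (v.adicCompletionIntegers ℚ)).kodairaSymbolOfMinimal = T)
    (hn : (IsDiscreteValuationRing.addVal (v.adicCompletionIntegers ℚ)
        ((W.baseChange (v.adicCompletion ℚ)).integralModel (v.adicCompletionIntegers ℚ)).Δ).toNat = n) :
    W.kodairaSymbolAt v = T ∧ W.ordMinimalDiscriminant v = n := by
  haveI hXell : (W.baseChange (v.adicCompletion ℚ)).IsElliptic := by
    rw [WeierstrassCurve.baseChange]; infer_instance
  have hrel : W.baseChange (v.adicCompletion ℚ) =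
      (1 : VariableChange (v.adicCompletion ℚ)) • W.baseChange (v.adicCompletion ℚ) :=
    (one_smul _ _).symm
  have hΔ := (W.baseChange (v.adicCompletion ℚ)).isUnit_Δ.ne_zero
  exact ⟨by rw [W.kodairaSymbolAt_eq_kodairaSymbolOfMinimal_of_isMinimal v _ 1 hrel hΔ, hK],
    by rw [W.ordMinimalDiscriminant_eq_of_isMinimal v _ 1 hrel hΔ, hn]⟩

/-- **`y² = x³ + 2u`, `u` odd: type `II` at `2`, `ord₂ Δ_min = 6`** (`f₂ = 6`, `δ₂ = 4`).
Silverman *ATAEC* IV.9.4 and Table 4.1. [cite: SilvermanATAEC1994, IV.9.4 (PDF pp. 344–346) and Table 4.1] -/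
theorem kodairaSymbolAt_and_ordMinimalDiscriminant_mordell_one
    [PerfectField (IsLocalRing.ResidueField (v.adicCompletionIntegers ℚ))]
    (hv : natGenerator v = 2) (W : WeierstrassCurve ℚ) [W.IsElliptic]
    (h₁ : W.a₁ = 0) (h₂ : W.a₂ = 0) (h₃ : W.a₃ = 0) (h₄ : W.a₄ = 0) {u : ℤ} (hu : ¬ (2 : ℤ) ∣ u)
    (ha₆ : W.a₆ = ((2 * u : ℤ) : ℚ)) :
    W.kodairaSymbolAt v = .II ∧ W.ordMinimalDiscriminant v = 6 := by
  obtain ⟨hint, hXΔ, -⟩ := mordell_baseChange_data v hv W h₁ h₂ h₃ h₄ ha₆ hu (a := 1) (by ring)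
  haveI := hint
  obtain ⟨hint', i1, i2, i3, i4, -, ⟨γ, hγ, i6⟩, hn⟩ :=
    mordell_integralModel_data v hv W h₁ h₂ h₃ h₄ ha₆ hu (a := 1) (by ring)
  haveI : (W.baseChange (v.adicCompletion ℚ)).IsMinimal (v.adicCompletionIntegers ℚ) :=
    isMinimal_of_exp_neg_twelve_lt_valued_Δ v _
      (by rw [hXΔ]; exact WithZero.exp_lt_exp.mpr (by norm_num))
  obtain ⟨ε, -, h2ε⟩ := exists_isUnit_two_eq_uniformizer_mul v hv
  refine kodairaSymbolAt_and_ordMinimalDiscriminant_mordell_of_isMinimal v W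
    (kodairaSymbolOfMinimal_mordell_one_eq_II i1 i2 i3 i4 h2ε (by rw [i6, pow_one]) hγ) hn

/-- **`y² = x³ + u`, `u ≡ 3 (mod 4)`: type `II` at `2`, `ord₂ Δ_min = 4`** (`f₂ = 4`, `δ₂ = 2`).
Silverman *ATAEC* IV.9.4 and Table 4.1. [cite: SilvermanATAEC1994, IV.9.4 (PDF pp. 344–346) and Table 4.1] -/
theorem kodairaSymbolAt_and_ordMinimalDiscriminant_mordell_zero_of_emod_four_eq_three
    [PerfectField (IsLocalRing.ResidueField (v.adicCompletionIntegers ℚ))]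
    (hv : natGenerator v = 2) (W : WeierstrassCurve ℚ) [W.IsElliptic]
    (h₁ : W.a₁ = 0) (h₂ : W.a₂ = 0) (h₃ : W.a₃ = 0) (h₄ : W.a₄ = 0) {u : ℤ} (hu : u % 4 = 3)
    (ha₆ : W.a₆ = (u : ℚ)) :
    W.kodairaSymbolAt v = .II ∧ W.ordMinimalDiscriminant v = 4 := by
  have hu2 : ¬ (2 : ℤ) ∣ u := by omega
  obtain ⟨hint, hXΔ, -⟩ := mordell_baseChange_data v hv W h₁ h₂ h₃ h₄ ha₆ hu2 (a := 0) (by ring)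
  haveI := hint
  obtain ⟨hint', i1, i2, i3, i4, i6v, -, hn⟩ :=
    mordell_integralModel_data v hv W h₁ h₂ h₃ h₄ ha₆ hu2 (a := 0) (by ring)
  haveI : (W.baseChange (v.adicCompletion ℚ)).IsMinimal (v.adicCompletionIntegers ℚ) :=
    isMinimal_of_exp_neg_twelve_lt_valued_Δ v _
      (by rw [hXΔ]; exact WithZero.exp_lt_exp.mpr (by norm_num))
  obtain ⟨ε, -, h2ε⟩ := exists_isUnit_two_eq_uniformizer_mul v hv
  set A₆ := ((W.baseChange (v.adicCompletion ℚ)).integralModel (v.adicCompletionIntegers ℚ)).a₆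
  -- `a₆ - 1 = ϖδ` with `δ` a unit (`u - 1 = 2·odd`)
  obtain ⟨m, hm⟩ : ∃ m : ℤ, u - 1 = 2 ^ 1 * m ∧ ¬ (2 : ℤ) ∣ m := ⟨(u - 1) / 2, by omega, by omega⟩
  have hval : Valued.v (((A₆ - 1 : v.adicCompletionIntegers ℚ) : v.adicCompletionIntegers ℚ) :
      v.adicCompletion ℚ) = WithZero.exp (-((1 : ℕ) : ℤ)) := by
    push_cast
    rw [i6v, ← map_one (algebraMap ℚ (v.adicCompletion ℚ)), ← map_sub,
      valued_algebraMap_adicCompletion, show (u : ℚ) - 1 = ((u - 1 : ℤ) : ℚ) by push_cast; ring]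
    exact valuation_intCast_of_eq_two_pow_mul v hv hm.1 hm.2
  obtain ⟨δ, hδ, hA⟩ := exists_isUnit_eq_uniformizer_pow_mul_of_valued_eq v hval
  rw [pow_one] at hA
  have hA₆ : A₆ = 1 + uniformizer (v.adicCompletionIntegers ℚ) * δ := by rw [← hA]; ring
  exact kodairaSymbolAt_and_ordMinimalDiscriminant_mordell_of_isMinimal v W
    (kodairaSymbolOfMinimal_mordell_zero_eq_II i1 i2 i3 i4 h2ε hA₆ hδ) hn

/-- **`y² = x³ + u`, `u ≡ 1 (mod 4)`: type `IV` at `2`, `ord₂ Δ_min = 4`** (`f₂ = 2`, `δ₂ = 0`).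
Silverman *ATAEC* IV.9.4 and Table 4.1. [cite: SilvermanATAEC1994, IV.9.4 (PDF pp. 344–346) and Table 4.1] -/
theorem kodairaSymbolAt_and_ordMinimalDiscriminant_mordell_zero_of_emod_four_eq_one
    [PerfectField (IsLocalRing.ResidueField (v.adicCompletionIntegers ℚ))]
    (hv : natGenerator v = 2) (W : WeierstrassCurve ℚ) [W.IsElliptic]
    (h₁ : W.a₁ = 0) (h₂ : W.a₂ = 0) (h₃ : W.a₃ = 0) (h₄ : W.a₄ = 0) {u : ℤ} (hu : u % 4 = 1)
    (ha₆ : W.a₆ = (u : ℚ)) :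
    W.kodairaSymbolAt v = .IV ∧ W.ordMinimalDiscriminant v = 4 := by
  have hu2 : ¬ (2 : ℤ) ∣ u := by omega
  obtain ⟨hint, hXΔ, -⟩ := mordell_baseChange_data v hv W h₁ h₂ h₃ h₄ ha₆ hu2 (a := 0) (by ring)
  haveI := hint
  obtain ⟨hint', i1, i2, i3, i4, i6v, -, hn⟩ :=
    mordell_integralModel_data v hv W h₁ h₂ h₃ h₄ ha₆ hu2 (a := 0) (by ring)
  haveI : (W.baseChange (v.adicCompletion ℚ)).IsMinimal (v.adicCompletionIntegers ℚ) :=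
    isMinimal_of_exp_neg_twelve_lt_valued_Δ v _
      (by rw [hXΔ]; exact WithZero.exp_lt_exp.mpr (by norm_num))
  obtain ⟨ε, hεu, h2ε⟩ := exists_isUnit_two_eq_uniformizer_mul v hv
  set A₆ := ((W.baseChange (v.adicCompletion ℚ)).integralModel (v.adicCompletionIntegers ℚ)).a₆
  -- `ϖ² ∣ a₆ - 1` (`4 ∣ u - 1`)
  have hval : Valued.v (((A₆ - 1 : v.adicCompletionIntegers ℚ) : v.adicCompletionIntegers ℚ) :
      v.adicCompletion ℚ) ≤ WithZero.exp (-((2 : ℕ) : ℤ)) := by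
    push_cast
    rw [i6v, ← map_one (algebraMap ℚ (v.adicCompletion ℚ)), ← map_sub,
      valued_algebraMap_adicCompletion, show (u : ℚ) - 1 = ((u - 1 : ℤ) : ℚ) by push_cast; ring]
    exact valuation_intCast_le_of_two_pow_dvd v hv (e := 2) (by norm_num; omega)
  obtain ⟨δ, hA⟩ := uniformizer_pow_dvd_of_valued_le v hval
  have hA₆ : A₆ = 1 + uniformizer (v.adicCompletionIntegers ℚ) ^ 2 * δ := by rw [← hA]; ring
  exact kodairaSymbolAt_and_ordMinimalDiscriminant_mordell_of_isMinimal v W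
    (kodairaSymbolOfMinimal_mordell_zero_eq_IV i1 i2 i3 i4 h2ε hεu hA₆) hn

/-- For `A₆ ∈ O_v` with `A₆ = k` in `ℚ_v`, `k = 4u`: `A₆ - ϖ² = (k - 4) + (4 - ϖ²)`, and
`|4 - ϖ²| ≤ 2⁻⁵`. [folklore] -/
theorem valued_sub_uniformizer_sq_of_four_mul (hv : natGenerator v = 2)
    {ε : v.adicCompletionIntegers ℚ} (hεu : IsUnit ε)
    (h2ε : (2 : v.adicCompletionIntegers ℚ) = uniformizer (v.adicCompletionIntegers ℚ) * ε)
    {A₆ : v.adicCompletionIntegers ℚ} {u : ℤ}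
    (hA : ((A₆ : v.adicCompletionIntegers ℚ) : v.adicCompletion ℚ) =
      algebraMap ℚ (v.adicCompletion ℚ) ((4 * u : ℤ) : ℚ)) :
    (u % 4 = 3 → Valued.v (((A₆ - uniformizer (v.adicCompletionIntegers ℚ) ^ 2 :
        v.adicCompletionIntegers ℚ) : v.adicCompletionIntegers ℚ) : v.adicCompletion ℚ) =
        WithZero.exp (-((3 : ℕ) : ℤ))) ∧
    (u % 4 = 1 → Valued.v (((A₆ - uniformizer (v.adicCompletionIntegers ℚ) ^ 2 :
        v.adicCompletionIntegers ℚ) : v.adicCompletionIntegers ℚ) : v.adicCompletion ℚ) ≤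
        WithZero.exp (-((4 : ℕ) : ℤ))) := by
  have h4π := valued_four_sub_uniformizer_sq_le v hv hεu h2ε
  set π : v.adicCompletion ℚ := ((uniformizer (v.adicCompletionIntegers ℚ) :
    v.adicCompletionIntegers ℚ) : v.adicCompletion ℚ) with hπ
  have e : (((A₆ - uniformizer (v.adicCompletionIntegers ℚ) ^ 2 : v.adicCompletionIntegers ℚ) :
      v.adicCompletionIntegers ℚ) : v.adicCompletion ℚ) =
      algebraMap ℚ (v.adicCompletion ℚ) ((4 * u - 4 : ℤ) : ℚ) + ((4 : v.adicCompletion ℚ) - π ^ 2) := by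
    have hl : (((A₆ - uniformizer (v.adicCompletionIntegers ℚ) ^ 2 : v.adicCompletionIntegers ℚ) :
        v.adicCompletionIntegers ℚ) : v.adicCompletion ℚ) = (A₆ : v.adicCompletion ℚ) - π ^ 2 := by
      push_cast; rfl
    have e' : algebraMap ℚ (v.adicCompletion ℚ) ((4 * u - 4 : ℤ) : ℚ) =
        algebraMap ℚ (v.adicCompletion ℚ) ((4 * u : ℤ) : ℚ) - 4 := by
      rw [show ((4 * u - 4 : ℤ) : ℚ) = ((4 * u : ℤ) : ℚ) - 4 by push_cast; ring, map_sub, map_ofNat]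
    rw [hl, hA, e']; ring
  have hval : ∀ m : ℤ, Valued.v (algebraMap ℚ (v.adicCompletion ℚ) (m : ℚ)) = v.valuation ℚ (m : ℚ) :=
    fun m ↦ valued_algebraMap_adicCompletion v _
  constructor
  · intro hu
    obtain ⟨m, hm⟩ : ∃ m : ℤ, 4 * u - 4 = 2 ^ 3 * m ∧ ¬ (2 : ℤ) ∣ m :=
      ⟨(u - 1) / 2, by omega, by omega⟩
    have h1 : Valued.v (algebraMap ℚ (v.adicCompletion ℚ) ((4 * u - 4 : ℤ) : ℚ)) =
        WithZero.exp (-((3 : ℕ) : ℤ)) := by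
      rw [hval]; exact valuation_intCast_of_eq_two_pow_mul v hv hm.1 hm.2
    rw [e, Valuation.map_add_eq_of_lt_left _ (by
      rw [h1]; exact lt_of_le_of_lt h4π (WithZero.exp_lt_exp.mpr (by norm_num))), h1]
  · intro hu
    have h1 : Valued.v (algebraMap ℚ (v.adicCompletion ℚ) ((4 * u - 4 : ℤ) : ℚ)) ≤
        WithZero.exp (-((4 : ℕ) : ℤ)) := by
      rw [hval]; exact valuation_intCast_le_of_two_pow_dvd v hv (e := 4) (by norm_num; omega)
    rw [e]
    exact Valuation.map_add_le _ h1 (h4π.trans (WithZero.exp_le_exp.mpr (by norm_num)))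

/-- **`y² = x³ + 4u`, `u ≡ 3 (mod 4)`: type `I₀*` at `2`, `ord₂ Δ_min = 8`** (`f₂ = 4`, `δ₂ = 2`).
Silverman *ATAEC* IV.9.4 and Table 4.1. [cite: SilvermanATAEC1994, IV.9.4 (PDF pp. 344–346) and Table 4.1] -/
theorem kodairaSymbolAt_and_ordMinimalDiscriminant_mordell_two_of_emod_four_eq_three
    [PerfectField (IsLocalRing.ResidueField (v.adicCompletionIntegers ℚ))]
    (hv : natGenerator v = 2) (W : WeierstrassCurve ℚ) [W.IsElliptic]
    (h₁ : W.a₁ = 0) (h₂ : W.a₂ = 0) (h₃ : W.a₃ = 0) (h₄ : W.a₄ = 0) {u : ℤ} (hu : u % 4 = 3)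
    (ha₆ : W.a₆ = ((4 * u : ℤ) : ℚ)) :
    W.kodairaSymbolAt v = .Istar 0 ∧ W.ordMinimalDiscriminant v = 8 := by
  have hu2 : ¬ (2 : ℤ) ∣ u := by omega
  obtain ⟨hint, hXΔ, -⟩ := mordell_baseChange_data v hv W h₁ h₂ h₃ h₄ ha₆ hu2 (a := 2) (by ring)
  haveI := hint
  obtain ⟨hint', i1, i2, i3, i4, i6v, -, hn⟩ :=
    mordell_integralModel_data v hv W h₁ h₂ h₃ h₄ ha₆ hu2 (a := 2) (by ring)
  haveI : (W.baseChange (v.adicCompletion ℚ)).IsMinimal (v.adicCompletionIntegers ℚ) :=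
    isMinimal_of_exp_neg_twelve_lt_valued_Δ v _
      (by rw [hXΔ]; exact WithZero.exp_lt_exp.mpr (by norm_num))
  obtain ⟨ε, hεu, h2ε⟩ := exists_isUnit_two_eq_uniformizer_mul v hv
  set A₆ := ((W.baseChange (v.adicCompletion ℚ)).integralModel (v.adicCompletionIntegers ℚ)).a₆
  obtain ⟨δ, hδ, hA⟩ := exists_isUnit_eq_uniformizer_pow_mul_of_valued_eq v
    ((valued_sub_uniformizer_sq_of_four_mul v hv hεu h2ε i6v).1 hu)
  have hA₆ : A₆ = uniformizer (v.adicCompletionIntegers ℚ) ^ 2 *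
      (1 + uniformizer (v.adicCompletionIntegers ℚ) * δ) := by
    have : A₆ = uniformizer (v.adicCompletionIntegers ℚ) ^ 2 + uniformizer _ ^ 3 * δ := by
      rw [← hA]; ring
    rw [this]; ring
  exact kodairaSymbolAt_and_ordMinimalDiscriminant_mordell_of_isMinimal v W
    (kodairaSymbolOfMinimal_mordell_two_eq_Istar_zero i1 i2 i3 i4 h2ε hA₆ hδ) hn

/-- **`y² = x³ + 4u`, `u ≡ 1 (mod 4)`: type `IV*` at `2`, `ord₂ Δ_min = 8`** (`f₂ = 2`, `δ₂ = 0`).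
Silverman *ATAEC* IV.9.4 and Table 4.1. [cite: SilvermanATAEC1994, IV.9.4 (PDF pp. 344–346) and Table 4.1] -/
theorem kodairaSymbolAt_and_ordMinimalDiscriminant_mordell_two_of_emod_four_eq_one
    [PerfectField (IsLocalRing.ResidueField (v.adicCompletionIntegers ℚ))]
    (hv : natGenerator v = 2) (W : WeierstrassCurve ℚ) [W.IsElliptic]
    (h₁ : W.a₁ = 0) (h₂ : W.a₂ = 0) (h₃ : W.a₃ = 0) (h₄ : W.a₄ = 0) {u : ℤ} (hu : u % 4 = 1)
    (ha₆ : W.a₆ = ((4 * u : ℤ) : ℚ)) :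
    W.kodairaSymbolAt v = .IVstar ∧ W.ordMinimalDiscriminant v = 8 := by
  have hu2 : ¬ (2 : ℤ) ∣ u := by omega
  obtain ⟨hint, hXΔ, -⟩ := mordell_baseChange_data v hv W h₁ h₂ h₃ h₄ ha₆ hu2 (a := 2) (by ring)
  haveI := hint
  obtain ⟨hint', i1, i2, i3, i4, i6v, -, hn⟩ :=
    mordell_integralModel_data v hv W h₁ h₂ h₃ h₄ ha₆ hu2 (a := 2) (by ring)
  haveI : (W.baseChange (v.adicCompletion ℚ)).IsMinimal (v.adicCompletionIntegers ℚ) :=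
    isMinimal_of_exp_neg_twelve_lt_valued_Δ v _
      (by rw [hXΔ]; exact WithZero.exp_lt_exp.mpr (by norm_num))
  obtain ⟨ε, hεu, h2ε⟩ := exists_isUnit_two_eq_uniformizer_mul v hv
  set A₆ := ((W.baseChange (v.adicCompletion ℚ)).integralModel (v.adicCompletionIntegers ℚ)).a₆
  obtain ⟨δ, hA⟩ := uniformizer_pow_dvd_of_valued_le v
    ((valued_sub_uniformizer_sq_of_four_mul v hv hεu h2ε i6v).2 hu)
  have hA₆ : A₆ = uniformizer (v.adicCompletionIntegers ℚ) ^ 2 *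
      (1 + uniformizer (v.adicCompletionIntegers ℚ) ^ 2 * δ) := by
    have : A₆ = uniformizer (v.adicCompletionIntegers ℚ) ^ 2 + uniformizer _ ^ 4 * δ := by
      rw [← hA]; ring
    rw [this]; ring
  exact kodairaSymbolAt_and_ordMinimalDiscriminant_mordell_of_isMinimal v W
    (kodairaSymbolOfMinimal_mordell_two_eq_IVstar i1 i2 i3 i4 h2ε hεu hA₆) hn

/-- **`y² = x³ + 8u`, `u` odd: type `I₀*` at `2`, `ord₂ Δ_min = 10`** (`f₂ = 6`, `δ₂ = 4`).
Silverman *ATAEC* IV.9.4 and Table 4.1. [cite: SilvermanATAEC1994, IV.9.4 (PDF pp. 344–346) and Table 4.1] -/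
theorem kodairaSymbolAt_and_ordMinimalDiscriminant_mordell_three
    [PerfectField (IsLocalRing.ResidueField (v.adicCompletionIntegers ℚ))]
    (hv : natGenerator v = 2) (W : WeierstrassCurve ℚ) [W.IsElliptic]
    (h₁ : W.a₁ = 0) (h₂ : W.a₂ = 0) (h₃ : W.a₃ = 0) (h₄ : W.a₄ = 0) {u : ℤ} (hu : ¬ (2 : ℤ) ∣ u)
    (ha₆ : W.a₆ = ((8 * u : ℤ) : ℚ)) :
    W.kodairaSymbolAt v = .Istar 0 ∧ W.ordMinimalDiscriminant v = 10 := by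
  obtain ⟨hint, hXΔ, -⟩ := mordell_baseChange_data v hv W h₁ h₂ h₃ h₄ ha₆ hu (a := 3) (by ring)
  haveI := hint
  obtain ⟨hint', i1, i2, i3, i4, -, ⟨γ, hγ, i6⟩, hn⟩ :=
    mordell_integralModel_data v hv W h₁ h₂ h₃ h₄ ha₆ hu (a := 3) (by ring)
  haveI : (W.baseChange (v.adicCompletion ℚ)).IsMinimal (v.adicCompletionIntegers ℚ) :=
    isMinimal_of_exp_neg_twelve_lt_valued_Δ v _
      (by rw [hXΔ]; exact WithZero.exp_lt_exp.mpr (by norm_num))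
  obtain ⟨ε, -, h2ε⟩ := exists_isUnit_two_eq_uniformizer_mul v hv
  exact kodairaSymbolAt_and_ordMinimalDiscriminant_mordell_of_isMinimal v W
    (kodairaSymbolOfMinimal_mordell_three_eq_Istar_zero i1 i2 i3 i4 h2ε i6 hγ) hn

/-- **Kraus's conditions fail for the descents of `y² = x³ + k`, `k ∈ {16u (u ≡ 3 mod 4), 32u (u
odd)}`.**  With `c₄ = 0` and `c₆ = -864k = 64q` (`q = -216u`, resp. `-432u`), for a unit `w` the
descended pair is `(0, q/w⁶)`: `|q/w⁶| = |q| > 2⁻⁵`; `q/w⁶ - 8 = (q - 8 - 8(w⁶ - 1))/w⁶` has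
`|·| = |q - 8| > 2⁻⁵` (`|w⁶ - 1| ≤ 2⁻³`); `|q/w⁶ + 1| = 1`.  Kraus 1989, Prop. 2.
[cite: Kraus1989, Prop. 2] -/
theorem kraus_fails_of_c₄_eq_zero (hv : natGenerator v = 2) {c₄ c₆ : v.adicCompletion ℚ}
    {q : ℤ} (hc₆ : c₆ = 64 * algebraMap ℚ (v.adicCompletion ℚ) (q : ℚ))
    (hqa : WithZero.exp (-5 : ℤ) < v.valuation ℚ (q : ℚ)) (hqb : v.valuation ℚ (q : ℚ) < 1)
    (hqc : WithZero.exp (-5 : ℤ) < v.valuation ℚ ((q : ℚ) - 8))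
    {w : v.adicCompletion ℚ} (hw : Valued.v w = 1) :
    ¬ ((Valued.v (c₄ / (16 * w ^ 4)) ≤ WithZero.exp (-4 : ℤ) ∧
        (Valued.v (c₆ / (64 * w ^ 6)) ≤ WithZero.exp (-5 : ℤ) ∨
          Valued.v (c₆ / (64 * w ^ 6) - 8) ≤ WithZero.exp (-5 : ℤ))) ∨
      Valued.v (c₆ / (64 * w ^ 6) + 1) ≤ WithZero.exp (-2 : ℤ)) := by
  have V2 := valued_two v hv
  have h20 : (2 : v.adicCompletion ℚ) ≠ 0 := by
    intro h; rw [h, Valuation.map_zero] at V2; exact WithZero.coe_ne_zero V2.symm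
  have h64 : (64 : v.adicCompletion ℚ) ≠ 0 := by
    rw [show (64 : v.adicCompletion ℚ) = 2 ^ 6 by norm_num]; exact pow_ne_zero _ h20
  have hw0 : w ≠ 0 := by
    intro h; rw [h, Valuation.map_zero] at hw; exact zero_ne_one hw
  have hw6 : Valued.v (w ^ 6) = 1 := by rw [Valuation.map_pow, hw, one_pow]
  set Q : v.adicCompletion ℚ := algebraMap ℚ (v.adicCompletion ℚ) (q : ℚ) with hQ
  have VQ : Valued.v Q = v.valuation ℚ (q : ℚ) := valued_algebraMap_adicCompletion v _
  have VQ8 : Valued.v (Q - 8) = v.valuation ℚ ((q : ℚ) - 8) := by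
    rw [hQ, ← map_ofNat (algebraMap ℚ (v.adicCompletion ℚ)) 8, ← map_sub,
      valued_algebraMap_adicCompletion]
  have hdesc : c₆ / (64 * w ^ 6) = Q / w ^ 6 := by
    rw [hc₆]; field_simp
  have V8 : Valued.v (8 : v.adicCompletion ℚ) = WithZero.exp (-3 : ℤ) := by
    rw [show (8 : v.adicCompletion ℚ) = 2 ^ 3 by norm_num, Valuation.map_pow, V2,
      ← WithZero.exp_nsmul]; norm_num
  rintro (⟨-, h | h⟩ | h)
  · -- `|q/w⁶| ≤ 2⁻⁵` contradicts `|q| > 2⁻⁵`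
    rw [hdesc, map_div₀, hw6, div_one, VQ] at h
    exact not_lt.mpr h hqa
  · -- `|q/w⁶ - 8| ≤ 2⁻⁵`
    have e : Q / w ^ 6 - 8 = ((Q - 8) + -(8 * (w ^ 6 - 1))) / w ^ 6 := by
      field_simp; ring
    have hsmall : Valued.v (-(8 * (w ^ 6 - 1))) < Valued.v (Q - 8) := by
      rw [Valuation.map_neg, Valuation.map_mul, V8, VQ8]
      calc WithZero.exp (-3 : ℤ) * Valued.v (w ^ 6 - 1)
          ≤ WithZero.exp (-3 : ℤ) * WithZero.exp (-3 : ℤ) :=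
            mul_le_mul' le_rfl (valued_pow_six_sub_one_le v hv hw)
        _ = WithZero.exp (-6 : ℤ) := by rw [withZero_exp_mul_exp]; norm_num
        _ < WithZero.exp (-5 : ℤ) := WithZero.exp_lt_exp.mpr (by norm_num)
        _ < v.valuation ℚ ((q : ℚ) - 8) := hqc
    rw [hdesc, e, map_div₀, hw6, div_one, Valuation.map_add_eq_of_lt_left _ hsmall, VQ8] at h
    exact not_lt.mpr h hqc
  · -- `|q/w⁶ + 1| ≤ 2⁻²` contradicts `|q/w⁶ + 1| = 1`
    have e : Q / w ^ 6 + 1 = (w ^ 6 + Q) / w ^ 6 := by field_simp; ring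
    have hlt : Valued.v Q < Valued.v (w ^ 6) := by rw [hw6, VQ]; exact hqb
    rw [hdesc, e, map_div₀, Valuation.map_add_eq_of_lt_left _ hlt, hw6, div_one,
      ← WithZero.exp_zero, WithZero.exp_le_exp] at h
    omega

/-- For `A₆ ∈ O_v` with `A₆ = 16u` in `ℚ_v`, `u ≡ 3 (mod 4)`: `|A₆ - ϖ⁴| = 2⁻⁵`
(`A₆ - ϖ⁴ = (16u - 16) + (16 - ϖ⁴)`, `|16 - ϖ⁴| = |4 - ϖ²|·|4 + ϖ²| ≤ 2⁻⁷`). [folklore] -/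
theorem valued_sub_uniformizer_pow_four_of_sixteen_mul (hv : natGenerator v = 2)
    {ε : v.adicCompletionIntegers ℚ} (hεu : IsUnit ε)
    (h2ε : (2 : v.adicCompletionIntegers ℚ) = uniformizer (v.adicCompletionIntegers ℚ) * ε)
    {A₆ : v.adicCompletionIntegers ℚ} {u : ℤ} (hu : u % 4 = 3)
    (hA : ((A₆ : v.adicCompletionIntegers ℚ) : v.adicCompletion ℚ) =
      algebraMap ℚ (v.adicCompletion ℚ) ((16 * u : ℤ) : ℚ)) :
    Valued.v (((A₆ - uniformizer (v.adicCompletionIntegers ℚ) ^ 4 :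
        v.adicCompletionIntegers ℚ) : v.adicCompletionIntegers ℚ) : v.adicCompletion ℚ) =
      WithZero.exp (-((5 : ℕ) : ℤ)) := by
  obtain ⟨hϖ, -⟩ := valued_uniformizer_and_eps v hv hεu h2ε
  have h4π := valued_four_sub_uniformizer_sq_le v hv hεu h2ε
  set π : v.adicCompletion ℚ := ((uniformizer (v.adicCompletionIntegers ℚ) :
    v.adicCompletionIntegers ℚ) : v.adicCompletion ℚ) with hπ
  have V4 := valued_four v hv
  have h4π' : Valued.v ((4 : v.adicCompletion ℚ) + π ^ 2) ≤ WithZero.exp (-2 : ℤ) := by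
    refine Valuation.map_add_le _ V4.le ?_
    rw [Valuation.map_pow, hϖ, ← WithZero.exp_nsmul]; norm_num
  have h16 : Valued.v ((16 : v.adicCompletion ℚ) - π ^ 4) ≤ WithZero.exp (-7 : ℤ) := by
    have e : (16 : v.adicCompletion ℚ) - π ^ 4 = (4 - π ^ 2) * (4 + π ^ 2) := by ring
    rw [e, Valuation.map_mul]
    calc Valued.v ((4 : v.adicCompletion ℚ) - π ^ 2) * Valued.v ((4 : v.adicCompletion ℚ) + π ^ 2)
        ≤ WithZero.exp (-5 : ℤ) * WithZero.exp (-2 : ℤ) := mul_le_mul' h4π h4π'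
      _ = WithZero.exp (-7 : ℤ) := by rw [withZero_exp_mul_exp]; norm_num
  have hl : (((A₆ - uniformizer (v.adicCompletionIntegers ℚ) ^ 4 : v.adicCompletionIntegers ℚ) :
      v.adicCompletionIntegers ℚ) : v.adicCompletion ℚ) = (A₆ : v.adicCompletion ℚ) - π ^ 4 := by
    push_cast; rfl
  have e' : algebraMap ℚ (v.adicCompletion ℚ) ((16 * u - 16 : ℤ) : ℚ) =
      algebraMap ℚ (v.adicCompletion ℚ) ((16 * u : ℤ) : ℚ) - 16 := by
    rw [show ((16 * u - 16 : ℤ) : ℚ) = ((16 * u : ℤ) : ℚ) - 16 by push_cast; ring, map_sub, map_ofNat]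
  have e : (A₆ : v.adicCompletion ℚ) - π ^ 4 =
      algebraMap ℚ (v.adicCompletion ℚ) ((16 * u - 16 : ℤ) : ℚ) + ((16 : v.adicCompletion ℚ) - π ^ 4) := by
    rw [hA, e']; ring
  obtain ⟨m, hm⟩ : ∃ m : ℤ, 16 * u - 16 = 2 ^ 5 * m ∧ ¬ (2 : ℤ) ∣ m :=
    ⟨(u - 1) / 2, by omega, by omega⟩
  have h1 : Valued.v (algebraMap ℚ (v.adicCompletion ℚ) ((16 * u - 16 : ℤ) : ℚ)) =
      WithZero.exp (-((5 : ℕ) : ℤ)) := by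
    rw [valued_algebraMap_adicCompletion]; exact valuation_intCast_of_eq_two_pow_mul v hv hm.1 hm.2
  rw [hl, e, Valuation.map_add_eq_of_lt_left _ (by
    rw [h1]; exact lt_of_le_of_lt h16 (WithZero.exp_lt_exp.mpr (by norm_num))), h1]

/-- **`y² = x³ + 16u`, `u ≡ 3 (mod 4)`: type `II*` at `2`, `ord₂ Δ_min = 12`** (`f₂ = 4`,
`δ₂ = 2`; the equation is minimal by Kraus).  Silverman *ATAEC* IV.9.4 and Table 4.1; Kraus 1989
Prop. 2. [cite: SilvermanATAEC1994, IV.9.4 (PDF pp. 344–346) and Table 4.1] [cite: Kraus1989, Prop. 2] -/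
theorem kodairaSymbolAt_and_ordMinimalDiscriminant_mordell_four_of_emod_four_eq_three
    [PerfectField (IsLocalRing.ResidueField (v.adicCompletionIntegers ℚ))]
    (hv : natGenerator v = 2) (W : WeierstrassCurve ℚ) [W.IsElliptic]
    (h₁ : W.a₁ = 0) (h₂ : W.a₂ = 0) (h₃ : W.a₃ = 0) (h₄ : W.a₄ = 0) {u : ℤ} (hu : u % 4 = 3)
    (ha₆ : W.a₆ = ((16 * u : ℤ) : ℚ)) :
    W.kodairaSymbolAt v = .IIstar ∧ W.ordMinimalDiscriminant v = 12 := by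
  have hu2 : ¬ (2 : ℤ) ∣ u := by omega
  obtain ⟨hint, hXΔ, -, hc₆, -⟩ := mordell_baseChange_data v hv W h₁ h₂ h₃ h₄ ha₆ hu2 (a := 4) (by ring)
  haveI := hint
  obtain ⟨hint', i1, i2, i3, i4, i6v, -, hn⟩ :=
    mordell_integralModel_data v hv W h₁ h₂ h₃ h₄ ha₆ hu2 (a := 4) (by ring)
  -- minimality (Kraus): `c₆ = 64 q` with `q = -216 u`
  have hv2 : v.valuation ℚ (2 : ℚ) = WithZero.exp (-1 : ℤ) := by
    have := Rat.valuation_natGenerator v; rwa [hv, Nat.cast_ofNat] at this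
  haveI : (W.baseChange (v.adicCompletion ℚ)).IsMinimal (v.adicCompletionIntegers ℚ) := by
    refine isMinimal_of_kraus_fails_of_Δ v hv _ (by rw [hXΔ]; exact WithZero.exp_lt_exp.mpr (by norm_num))
      fun w hw ↦ kraus_fails_of_c₄_eq_zero v hv (q := -216 * u) ?_ ?_ ?_ ?_ hw
    · rw [hc₆, map_intCast]; push_cast; ring
    · rw [valuation_intCast_of_eq_two_pow_mul v hv (m' := -27 * u) (e := 3) (by ring) (by omega)]
      exact WithZero.exp_lt_exp.mpr (by norm_num)
    · rw [valuation_intCast_of_eq_two_pow_mul v hv (m' := -27 * u) (e := 3) (by ring) (by omega),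
        ← WithZero.exp_zero]
      exact WithZero.exp_lt_exp.mpr (by norm_num)
    · obtain ⟨m, hm⟩ : ∃ m : ℤ, -216 * u - 8 = 2 ^ 4 * m ∧ ¬ (2 : ℤ) ∣ m :=
        ⟨(-27 * u - 1) / 2, by omega, by omega⟩
      rw [show ((-216 * u : ℤ) : ℚ) - 8 = ((-216 * u - 8 : ℤ) : ℚ) by push_cast; ring,
        valuation_intCast_of_eq_two_pow_mul v hv hm.1 hm.2]
      exact WithZero.exp_lt_exp.mpr (by norm_num)
  obtain ⟨ε, hεu, h2ε⟩ := exists_isUnit_two_eq_uniformizer_mul v hv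
  set A₆ := ((W.baseChange (v.adicCompletion ℚ)).integralModel (v.adicCompletionIntegers ℚ)).a₆
  obtain ⟨δ, hδ, hA⟩ := exists_isUnit_eq_uniformizer_pow_mul_of_valued_eq v
    (valued_sub_uniformizer_pow_four_of_sixteen_mul v hv hεu h2ε hu i6v)
  have hA₆ : A₆ = uniformizer (v.adicCompletionIntegers ℚ) ^ 4 *
      (1 + uniformizer (v.adicCompletionIntegers ℚ) * δ) := by
    have : A₆ = uniformizer (v.adicCompletionIntegers ℚ) ^ 4 + uniformizer _ ^ 5 * δ := by
      rw [← hA]; ring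
    rw [this]; ring
  exact kodairaSymbolAt_and_ordMinimalDiscriminant_mordell_of_isMinimal v W
    (kodairaSymbolOfMinimal_mordell_four_eq_IIstar i1 i2 i3 i4 h2ε hA₆ hδ) hn

/-- **`y² = x³ + 32u`, `u` odd: type `II*` at `2`, `ord₂ Δ_min = 14`** (`f₂ = 6`, `δ₂ = 4`; minimal
by Kraus).  Silverman *ATAEC* IV.9.4 and Table 4.1; Kraus 1989 Prop. 2.
[cite: SilvermanATAEC1994, IV.9.4 (PDF pp. 344–346) and Table 4.1] [cite: Kraus1989, Prop. 2] -/
theorem kodairaSymbolAt_and_ordMinimalDiscriminant_mordell_five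
    [PerfectField (IsLocalRing.ResidueField (v.adicCompletionIntegers ℚ))]
    (hv : natGenerator v = 2) (W : WeierstrassCurve ℚ) [W.IsElliptic]
    (h₁ : W.a₁ = 0) (h₂ : W.a₂ = 0) (h₃ : W.a₃ = 0) (h₄ : W.a₄ = 0) {u : ℤ} (hu : ¬ (2 : ℤ) ∣ u)
    (ha₆ : W.a₆ = ((32 * u : ℤ) : ℚ)) :
    W.kodairaSymbolAt v = .IIstar ∧ W.ordMinimalDiscriminant v = 14 := by
  obtain ⟨hint, hXΔ, -, hc₆, -⟩ := mordell_baseChange_data v hv W h₁ h₂ h₃ h₄ ha₆ hu (a := 5) (by ring)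
  haveI := hint
  obtain ⟨hint', i1, i2, i3, i4, -, ⟨γ, hγ, i6⟩, hn⟩ :=
    mordell_integralModel_data v hv W h₁ h₂ h₃ h₄ ha₆ hu (a := 5) (by ring)
  haveI : (W.baseChange (v.adicCompletion ℚ)).IsMinimal (v.adicCompletionIntegers ℚ) := by
    refine isMinimal_of_kraus_fails_of_Δ v hv _ (by rw [hXΔ]; exact WithZero.exp_lt_exp.mpr (by norm_num))
      fun w hw ↦ kraus_fails_of_c₄_eq_zero v hv (q := -432 * u) ?_ ?_ ?_ ?_ hw
    · rw [hc₆, map_intCast]; push_cast; ring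
    · rw [valuation_intCast_of_eq_two_pow_mul v hv (m' := -27 * u) (e := 4) (by ring) (by omega)]
      exact WithZero.exp_lt_exp.mpr (by norm_num)
    · rw [valuation_intCast_of_eq_two_pow_mul v hv (m' := -27 * u) (e := 4) (by ring) (by omega),
        ← WithZero.exp_zero]
      exact WithZero.exp_lt_exp.mpr (by norm_num)
    · obtain ⟨m, hm⟩ : ∃ m : ℤ, -432 * u - 8 = 2 ^ 3 * m ∧ ¬ (2 : ℤ) ∣ m :=
        ⟨-54 * u - 1, by omega, by omega⟩
      rw [show ((-432 * u : ℤ) : ℚ) - 8 = ((-432 * u - 8 : ℤ) : ℚ) by push_cast; ring,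
        valuation_intCast_of_eq_two_pow_mul v hv hm.1 hm.2]
      exact WithZero.exp_lt_exp.mpr (by norm_num)
  exact kodairaSymbolAt_and_ordMinimalDiscriminant_mordell_of_isMinimal v W
    (kodairaSymbolOfMinimal_mordell_five_eq_IIstar i1 i2 i3 i4 i6 hγ) hn

end MordellData

/-! ### `δ₂` of `y² = x³ + k`, and the good case `k = 16u`, `u ≡ 1 (mod 4)` -/

section Conductor

variable (v : HeightOneSpectrum (𝓞 ℚ))

/-- From the Kodaira type `T ∈ {II, IV, I₀*, IV*, II*}` and `ord Δ_min = n`: `δ_v = n + 1 - m(T) - 2`.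
[cite: SilvermanATAEC1994, IV.11.1 (Ogg's formula taken as definition) and Table 4.1] -/
theorem wildConductorExponent_eq_of_kodairaSymbolAt (W : WeierstrassCurve ℚ) {T : KodairaSymbol}
    {n : ℕ} (h : W.kodairaSymbolAt v = T ∧ W.ordMinimalDiscriminant v = n) :
    W.wildConductorExponent v = n + 1 - T.numComponents - T.tameConductorExponent := by
  unfold wildConductorExponent conductorExponent numComponentsAt
  rw [h.1, h.2]

/-- **`y² + y = x³ + (u - 1)/4`: the curve `y² = x³ + 16u`, `u ≡ 1 (mod 4)`, has good reduction
at `2`** (`(2; 0, 0, 4) • W = (0, 0, 1, 0, (u-1)/4)`, integral with unit discriminant `-27u²`).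
Silverman *AEC* VII.5 Prop. 5.1(a). [cite: SilvermanAEC2009, VII.5 Prop. 5.1(a) and VII.1 Remark 1.1] -/
theorem hasGoodReductionAt_mordell_four_of_emod_four_eq_one (hv : natGenerator v = 2)
    (W : WeierstrassCurve ℚ) (h₁ : W.a₁ = 0) (h₂ : W.a₂ = 0) (h₃ : W.a₃ = 0) (h₄ : W.a₄ = 0)
    {u : ℤ} (hu : u % 4 = 1) (ha₆ : W.a₆ = ((16 * u : ℤ) : ℚ)) : W.HasGoodReductionAt v := by
  obtain ⟨q, hq⟩ : ∃ q : ℤ, u - 1 = 4 * q := ⟨(u - 1) / 4, by omega⟩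
  set C : VariableChange ℚ := ⟨⟨2, 2⁻¹, by norm_num, by norm_num⟩, 0, 0, 4⟩ with hC
  set M := C • W with hM
  have e1 : M.a₁ = 0 := by rw [hM, hC, variableChange_a₁, h₁]; simp
  have e2 : M.a₂ = 0 := by rw [hM, hC, variableChange_a₂, h₁, h₂]; simp
  have e3 : M.a₃ = 1 := by
    rw [hM, hC, variableChange_a₃, h₁, h₃]; simp; norm_num
  have e4 : M.a₄ = 0 := by rw [hM, hC, variableChange_a₄, h₁, h₂, h₃, h₄]; simp
  have e6 : M.a₆ = (q : ℚ) := by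
    rw [hM, hC, variableChange_a₆, h₁, h₂, h₃, h₄, ha₆]
    simp
    have : (u : ℚ) = 4 * q + 1 := by exact_mod_cast (show u = 4 * q + 1 by omega)
    rw [this]; norm_num; ring
  have hΔW : W.Δ = -432 * ((16 * u : ℤ) : ℚ) ^ 2 := by
    rw [← ha₆]
    simp only [WeierstrassCurve.Δ, WeierstrassCurve.b₂, WeierstrassCurve.b₄, WeierstrassCurve.b₆,
      WeierstrassCurve.b₈, h₁, h₂, h₃, h₄]
    ring
  have eΔ : M.Δ = ((-27 * u ^ 2 : ℤ) : ℚ) := by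
    rw [hM, variableChange_Δ, hΔW, hC]; simp; ring
  have hvu : v.valuation ℚ (u : ℚ) = 1 := Rat.valuation_intCast_eq_one v (by rw [hv]; omega)
  have h27 : v.valuation ℚ ((-27 : ℤ) : ℚ) = 1 := Rat.valuation_intCast_eq_one v (by rw [hv]; decide)
  have hgood : M.HasGoodReductionAt v := by
    refine hasGoodReductionAt_of_valuation_le_one_of_valuation_Δ_eq_one v M ?_ ?_ ?_ ?_ ?_ ?_
    · rw [e1, map_zero]; exact zero_le_one
    · rw [e2, map_zero]; exact zero_le_one
    · rw [e3, map_one]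
    · rw [e4, map_zero]; exact zero_le_one
    · rw [e6, show (q : ℚ) = algebraMap (𝓞 ℚ) ℚ (q : 𝓞 ℚ) by simp]; exact v.valuation_le_one _
    · rw [eΔ]; push_cast; rw [map_mul, map_pow, hvu, one_pow, mul_one]; exact_mod_cast h27
  rw [hM] at hgood
  exact (hasGoodReductionAt_smul_iff_holds v W C).mp hgood

/-- **The wild exponent at `2` of `y² = x³ + k`, `k ∈ ℤ`, `64 ∤ k`: `δ₂ = 2δ₂(χ_{k₀})`.**  For `W` with
`a₁ = a₂ = a₃ = a₄ = 0`, `a₆ = k`, `64 ∤ k`, additive at the place `v` above `2`: writing `k = 2ᵃu`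
(`u` odd, `a ≤ 5`), `k = c²k₀` with `c = 2^{⌊a/2⌋}`, `k₀ = u` (`a` even) or `2u` (`a` odd), and
`δ_v = 0, 2, 4` according as `k₀ ≡ 1, 3, 2 (mod 4)` — by Tate's algorithm: types IV (`a = 0`,
`u ≡ 1`), IV* (`a = 2`, `u ≡ 1`) give `δ = 0`; II (`a = 0`, `u ≡ 3`), I₀* (`a = 2`, `u ≡ 3`), II*
(`a = 4`, `u ≡ 3`) give `δ = 2`; II (`a = 1`), I₀* (`a = 3`), II* (`a = 5`) give `δ = 4`; and
`a = 4`, `u ≡ 1 (mod 4)` is good reduction.  Silverman *ATAEC* IV.9.4, Table 4.1 and IV.11.1.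
[cite: SilvermanATAEC1994, IV.9.4, Table 4.1 and IV.11.1 (PDF pp. 344–346, 365)] -/
theorem exists_sq_mul_wildConductorExponent_mordell
    [PerfectField (IsLocalRing.ResidueField (v.adicCompletionIntegers ℚ))]
    (hv : natGenerator v = 2) (W : WeierstrassCurve ℚ) [W.IsElliptic]
    (h₁ : W.a₁ = 0) (h₂ : W.a₂ = 0) (h₃ : W.a₃ = 0) (h₄ : W.a₄ = 0) {k : ℤ} (hk0 : k ≠ 0)
    (hk : ¬ (64 : ℤ) ∣ k) (ha₆ : W.a₆ = (k : ℚ)) (hadd : W.HasAdditiveReductionAt v) :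
    ∃ c : ℚ, c ≠ 0 ∧ ∃ k₀ : ℤ, (k : ℚ) = c ^ 2 * k₀ ∧
      ((k₀ % 4 = 1 ∧ W.wildConductorExponent v = 0) ∨ (k₀ % 4 = 3 ∧ W.wildConductorExponent v = 2) ∨
        (k₀ % 4 = 2 ∧ W.wildConductorExponent v = 4)) := by
  -- `k = 2ᵃu`, `u` odd, `a ≤ 5`
  obtain ⟨a, m, hm, hkm⟩ := Nat.exists_eq_two_pow_mul_odd (Int.natAbs_ne_zero.mpr hk0)
  set u : ℤ := k.sign * m with hu_def
  have hku : k = 2 ^ a * u := by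
    have h1 : (k.natAbs : ℤ) = 2 ^ a * m := by exact_mod_cast hkm
    calc k = k.sign * (k.natAbs : ℤ) := (Int.sign_mul_natAbs k).symm
      _ = 2 ^ a * u := by rw [h1, hu_def]; ring
  have hu2 : ¬ (2 : ℤ) ∣ u := by
    rw [hu_def]
    intro h
    have h' := Int.natAbs_dvd_natAbs.mpr h
    rw [Int.natAbs_mul, Int.natAbs_sign_of_ne_zero hk0, one_mul, Int.natAbs_natCast] at h'
    exact (Nat.not_even_iff_odd.mpr hm) (even_iff_two_dvd.mpr (by exact_mod_cast h'))
  have ha : a ≤ 5 := by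
    by_contra h
    apply hk
    rw [hku]
    exact dvd_mul_of_dvd_left (by rw [show (64 : ℤ) = 2 ^ 6 by norm_num]; exact pow_dvd_pow 2 (by omega)) u
  have hu4 : u % 4 = 1 ∨ u % 4 = 3 := by omega
  interval_cases a
  · -- `a = 0`: `k = u`
    rw [pow_zero, one_mul] at hku
    refine ⟨1, one_ne_zero, u, by rw [hku]; ring, ?_⟩
    rcases hu4 with h | h
    · exact Or.inl ⟨h, by
        rw [W.wildConductorExponent_eq_of_kodairaSymbolAt v
          (kodairaSymbolAt_and_ordMinimalDiscriminant_mordell_zero_of_emod_four_eq_one v hv W h₁ h₂ h₃ h₄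
            h (by rw [ha₆, hku]))]; rfl⟩
    · exact Or.inr (Or.inl ⟨h, by
        rw [W.wildConductorExponent_eq_of_kodairaSymbolAt v
          (kodairaSymbolAt_and_ordMinimalDiscriminant_mordell_zero_of_emod_four_eq_three v hv W h₁ h₂ h₃ h₄
            h (by rw [ha₆, hku]))]; rfl⟩)
  · -- `a = 1`: `k = 2u`, `k₀ = 2u`
    refine ⟨1, one_ne_zero, 2 * u, by rw [hku]; push_cast; ring, Or.inr (Or.inr ⟨by omega, ?_⟩)⟩
    rw [W.wildConductorExponent_eq_of_kodairaSymbolAt v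
      (kodairaSymbolAt_and_ordMinimalDiscriminant_mordell_one v hv W h₁ h₂ h₃ h₄ hu2
        (by rw [ha₆, hku]; push_cast; ring))]
    rfl
  · -- `a = 2`: `k = 4u`, `c = 2`, `k₀ = u`
    refine ⟨2, two_ne_zero, u, by rw [hku]; push_cast; ring, ?_⟩
    rcases hu4 with h | h
    · exact Or.inl ⟨h, by
        rw [W.wildConductorExponent_eq_of_kodairaSymbolAt v
          (kodairaSymbolAt_and_ordMinimalDiscriminant_mordell_two_of_emod_four_eq_one v hv W h₁ h₂ h₃ h₄
            h (by rw [ha₆, hku]; push_cast; ring))]; rfl⟩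
    · exact Or.inr (Or.inl ⟨h, by
        rw [W.wildConductorExponent_eq_of_kodairaSymbolAt v
          (kodairaSymbolAt_and_ordMinimalDiscriminant_mordell_two_of_emod_four_eq_three v hv W h₁ h₂ h₃ h₄
            h (by rw [ha₆, hku]; push_cast; ring))]; rfl⟩)
  · -- `a = 3`: `k = 8u`, `c = 2`, `k₀ = 2u`
    refine ⟨2, two_ne_zero, 2 * u, by rw [hku]; push_cast; ring, Or.inr (Or.inr ⟨by omega, ?_⟩)⟩
    rw [W.wildConductorExponent_eq_of_kodairaSymbolAt v
      (kodairaSymbolAt_and_ordMinimalDiscriminant_mordell_three v hv W h₁ h₂ h₃ h₄ hu2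
        (by rw [ha₆, hku]; push_cast; ring))]
    rfl
  · -- `a = 4`: `k = 16u`, `c = 4`, `k₀ = u`; `u ≡ 1 (mod 4)` is good reduction
    refine ⟨4, by norm_num, u, by rw [hku]; push_cast; ring, ?_⟩
    rcases hu4 with h | h
    · exact absurd (hasGoodReductionAt_mordell_four_of_emod_four_eq_one v hv W h₁ h₂ h₃ h₄ h
        (by rw [ha₆, hku]; push_cast; ring)) hadd.not_hasGoodReductionAt
    · exact Or.inr (Or.inl ⟨h, by
        rw [W.wildConductorExponent_eq_of_kodairaSymbolAt v
          (kodairaSymbolAt_and_ordMinimalDiscriminant_mordell_four_of_emod_four_eq_three v hv W h₁ h₂ h₃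
            h₄ h (by rw [ha₆, hku]; push_cast; ring))]; rfl⟩)
  · -- `a = 5`: `k = 32u`, `c = 4`, `k₀ = 2u`
    refine ⟨4, by norm_num, 2 * u, by rw [hku]; push_cast; ring, Or.inr (Or.inr ⟨by omega, ?_⟩)⟩
    rw [W.wildConductorExponent_eq_of_kodairaSymbolAt v
      (kodairaSymbolAt_and_ordMinimalDiscriminant_mordell_five v hv W h₁ h₂ h₃ h₄ hu2
        (by rw [ha₆, hku]; push_cast; ring))]
    rfl

end Conductor

end WeierstrassCurve

end
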